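import Summits.NavierStokesRegularity.NavierStokesRegularity.Theorems.ScenarioCensusRowD9DissipationTools
import HarnessLib

/-!
# Census row D9 TYPED — part 7/9: G1, §6d second half — the dissipation bound for the zoomed pairing, the `L^p` zoom
# identity, the heart `integral_test_eq_zero_mod`, `modulatedDissipationGate_holds'` (G1 PROVED)

Re-homed for the scenario census (typer seat ns-census-typer-1 g7; in scope of the census KEY text «one `def Row_<k> : Prop`
per OPEN row» — row D9 was the one OPEN-NO-LINE row without a typed tree decl, typer-1 g6 HANDOFF 19:50Z; lead programme ended
at v1.67, base SUMMON-only; ANNOUNCE on the cell STATUS 2026-08-28T20:24Z): VERBATIM PORT of ns-idea-9 LINE 16 «modulation_gate»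
rev 5, `pub/ideators/ns-idea-9/lines/modulation_gate/modulation_gate.lean` sha16 1d7b2cd493e504e0 (2259 l., lean check rc 0,
0 sorry; critic idea-crit-8 V66/V67/V69 PASS-WITH-PRICE on rev 1–4, ref ns-census-ref g8 PRE-CHECK ✓ §13.14 [5/6] of rev 4
f704279be2039922; rev 5 = rev 4 + §6e «S0 proved»; TARGET-MENU r4 names this line as row D9's lever; CENSUS-FINAL r6 §2 lists
`row_F4bp_of_row_D9K` / `row_F4bpLH_of_row_D9LH` as FILES-ONLY edges), split for the 400-line rule into
`ScenarioCensusRowD9Modulation` (§1–§4) → `…RowD9Kernel` (§5) → `…RowD9PowerLaw` (§6) → `…RowD9CoreExponents` (§6c (i)–(iv)) →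
`…RowD9Core` (§6c (v)) → `…RowD9DissipationTools` (§6d, first half) → `…RowD9Dissipation` (§6d, second half) →
`…RowD9SteadyLimitTools` (§6e, first half) → `…RowD9` (§6e, second half; §7; census KEYS).  Lean text VERBATIM in namespace
`…Theorems.ScenarioCensus.ModulationGate` (the line's `…Cruxes.Row_F4bp.ModulationGate` re-homed); port edits: the two
`local notation "E3"` lines → `abbrev E3` (typer lint: no notation in port files), `@[conjecture]` added to the four OPEN
parameterless `def`s `Row_D9K` / `Row_D9LH` / `Row_D9LHWild` / `Row_F4bpLH` (obligation nodes), one-line docstrings added to twelve undocumented auxiliaries, the three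
`@[deprecated] stub_*` aliases of §7 not re-declared, four §7 docstrings updated to the rev-5 facts (everything proved); the two VERBATIM
re-statements of `CoreProof.eLpNorm_zoom` inside `DissipationProof` / `SteadyLimitProof` are not re-declared (gate lint `dedup.landed`) — their two
uses name `CoreProof.eLpNorm_zoom` (proof-only diffs).

No census value is asserted here (a summoned lead books row D9; FILES-ONLY edges become TREE by name); NS regularity is NOT
proved; rows D9 / F4b′ stay OPEN (= their wild residuals, by theorem); no summit statement is proved by this file.
-/

-- the summit and its single problem share the name `NavierStokesRegularity` (D-0017 nested layout)
set_option linter.dupNamespace false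

noncomputable section

open Set Function Filter Topology MeasureTheory Metric
open scoped NNReal ENNReal ContDiff

namespace Summit.NavierStokesRegularity.NavierStokesRegularity.Theorems.ScenarioCensus.ModulationGate

open Literature.Analysis Literature.Analysis.FluidPDE
open Summit.NavierStokesRegularity.NavierStokesRegularity.Theorems.ScenarioCensus

namespace DissipationProof

open scoped Convolution
open Literature.Analysis.FunctionSpaces

/-- **(iii) The dissipation bound for the zoomed pairing**: for `u` with weak gradient `G`,
`‖∫ (∂_w φ)(y) • ℓ u(ℓy) dy‖ ≤ ‖φ‖₂ ‖w‖ ℓ^{1/2} (∫|G|_F²)^{1/2}` — i.e. it is controlled by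
`ℓ ‖∇u‖₂² = ‖∇(zoom)‖₂²`. -/
theorem zoom_pairing_le {u : E3 → E3} {G : E3 → E3 →L[ℝ] E3} (hG : HasWeakGradient u G)
    {φ : E3 → ℝ} (hφ : IsTestFunctionOn (⊤ : TopologicalSpace.Opens E3) φ) {ℓ : ℝ} (hℓ : 0 < ℓ) (w : E3) :
    ‖∫ y, (fderiv ℝ φ y w) • (ℓ • u (ℓ • y))‖ₑ ≤
      eLpNorm φ 2 volume * ‖w‖ₑ * ENNReal.ofReal ℓ ^ (1 / 2 : ℝ) *
        (∫⁻ x, ENNReal.ofReal (frobeniusNormSq (G x))) ^ (1 / 2 : ℝ) := by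
  have hℓ0 : ℓ ≠ 0 := hℓ.ne'
  have hℓi : ℓ⁻¹ ≠ 0 := inv_ne_zero hℓ0
  have hφd : Differentiable ℝ φ := hφ.contDiff.differentiable (by simp)
  set ψ : E3 → ℝ := fun z => φ (ℓ⁻¹ • z) with hψ
  have hψt : IsTestFunctionOn (⊤ : TopologicalSpace.Opens E3) ψ := isTestFunctionOn_comp_smul hφ hℓi
  -- the weak-derivative identity for `u` tested with `ψ`
  have hweak : ∫ x, (fderiv ℝ ψ x w) • u x = -∫ x, ψ x • G x w := by
    have key := hG.integral_fderiv_smul_eq ψ w hψt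
    simpa only [TopologicalSpace.Opens.coe_top, Measure.restrict_univ] using key
  rw [zoom_pairing_eq hφd hℓ u w, hweak, smul_neg, enorm_neg, enorm_smul]
  -- measurability
  have hGm : AEStronglyMeasurable G volume :=
    (locallyIntegrableOn_univ.1 (by
      simpa only [TopologicalSpace.Opens.coe_top] using hG.locallyIntegrableOn_deriv)).aestronglyMeasurable
  have hGw : AEStronglyMeasurable (fun x => G x w) volume :=
    (ContinuousLinearMap.apply ℝ E3 w).continuous.comp_aestronglyMeasurable hGm
  have hψm : AEStronglyMeasurable ψ volume := hψt.contDiff.continuous.aestronglyMeasurable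
  have hφm : AEStronglyMeasurable φ volume := hφ.contDiff.continuous.aestronglyMeasurable
  -- Hölder (2,2;1)
  have hH : ‖∫ x, ψ x • G x w‖ₑ ≤ eLpNorm ψ 2 volume * eLpNorm (fun x => G x w) 2 volume := by
    calc ‖∫ x, ψ x • G x w‖ₑ ≤ ∫⁻ x, ‖ψ x • G x w‖ₑ := enorm_integral_le_lintegral_enorm _
      _ = eLpNorm (ψ • fun x => G x w) 1 volume := by
          rw [eLpNorm_one_eq_lintegral_enorm]; rfl
      _ ≤ eLpNorm ψ 2 volume * eLpNorm (fun x => G x w) 2 volume :=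
          eLpNorm_smul_le_mul_eLpNorm hGw hψm
  -- scaling of ‖ψ‖₂
  have hψ2 : eLpNorm ψ 2 volume = ENNReal.ofReal (ℓ ^ 3) ^ (1 / 2 : ℝ) * eLpNorm φ 2 volume := by
    have h := Literature.Analysis.OperatorTheory.eLpNorm_comp_smul (p := 2) hφm hℓi ENNReal.ofNat_ne_top
    rw [finrank_euclideanSpace_fin] at h
    have hq : (1 / (2 : ℝ≥0∞)).toReal = 1 / 2 := by
      rw [one_div, ENNReal.toReal_inv, ENNReal.toReal_ofNat, one_div]
    have habs : |((ℓ⁻¹) ^ 3)⁻¹| = ℓ ^ 3 := by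
      rw [inv_pow, inv_inv, abs_of_pos (pow_pos hℓ 3)]
    rw [hq, habs] at h
    exact h
  -- assemble
  have hreal : ENNReal.ofReal ℓ⁻¹ * ENNReal.ofReal (ℓ ^ 3) ^ (1 / 2 : ℝ) = ENNReal.ofReal ℓ ^ (1 / 2 : ℝ) := by
    rw [ENNReal.ofReal_rpow_of_nonneg (pow_nonneg hℓ.le 3) (by norm_num),
      ENNReal.ofReal_rpow_of_nonneg hℓ.le (by norm_num), ← ENNReal.ofReal_mul (inv_nonneg.2 hℓ.le)]
    congr 1
    rw [← Real.rpow_natCast ℓ 3, ← Real.rpow_mul hℓ.le, ← Real.rpow_neg_one, ← Real.rpow_add hℓ]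
    norm_num
  have hinv : ‖(ℓ⁻¹ : ℝ)‖ₑ = ENNReal.ofReal ℓ⁻¹ := by
    rw [Real.enorm_eq_ofReal (inv_nonneg.2 hℓ.le)]
  calc ‖(ℓ⁻¹ : ℝ)‖ₑ * ‖∫ x, ψ x • G x w‖ₑ
      ≤ ENNReal.ofReal ℓ⁻¹ * (eLpNorm ψ 2 volume * eLpNorm (fun x => G x w) 2 volume) := by
        rw [hinv]; gcongr
    _ ≤ ENNReal.ofReal ℓ⁻¹ * (ENNReal.ofReal (ℓ ^ 3) ^ (1 / 2 : ℝ) * eLpNorm φ 2 volume *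
          (‖w‖ₑ * (∫⁻ x, ENNReal.ofReal (frobeniusNormSq (G x))) ^ (1 / 2 : ℝ))) := by
        rw [hψ2]; gcongr; exact eLpNorm_apply_le w
    _ = (ENNReal.ofReal ℓ⁻¹ * ENNReal.ofReal (ℓ ^ 3) ^ (1 / 2 : ℝ)) * eLpNorm φ 2 volume * ‖w‖ₑ *
          (∫⁻ x, ENNReal.ofReal (frobeniusNormSq (G x))) ^ (1 / 2 : ℝ) := by ring
    _ = eLpNorm φ 2 volume * ‖w‖ₑ * ENNReal.ofReal ℓ ^ (1 / 2 : ℝ) *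
          (∫⁻ x, ENNReal.ofReal (frobeniusNormSq (G x))) ^ (1 / 2 : ℝ) := by
        rw [hreal]; ring

-- `eLpNorm_zoom`: the line restates `CoreProof.eLpNorm_zoom` here verbatim; the tree takes it BY NAME (gate lint dedup.landed).

/-- **(iv-mod) the relative deviation IS the `L^p` distance between the profile and the zoomed slice**:
`‖V̄ − λ⁻¹ v(t)(λ⁻¹·)‖_p = modulatedDeviation λ p v V̄ t` whenever `λ(t) > 0`. -/
theorem eLpNorm_profile_sub_zoom_mod {lam : ℝ → ℝ} {p : ℝ≥0}
    {v : ℝ → E3 → E3} {V : E3 → E3} (hV : AEStronglyMeasurable V volume) {t : ℝ} (hlt : 0 < lam t)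
    (hvt : AEStronglyMeasurable (v t) volume) :
    eLpNorm (fun y => V y - (lam t)⁻¹ • v t ((lam t)⁻¹ • y)) (p : ℝ≥0∞) volume =
      modulatedDeviation lam p v V t := by
  have hl0 : lam t ≠ 0 := hlt.ne'
  have hgm : AEStronglyMeasurable (fun x => v t x - lam t • V (lam t • x)) volume :=
    hvt.sub ((hV.comp_quasiMeasurePreserving
      (Literature.Analysis.OperatorTheory.quasiMeasurePreserving_smul' hl0)).const_smul (lam t))
  have hfun : (fun y => V y - (lam t)⁻¹ • v t ((lam t)⁻¹ • y)) =
      -(fun y => (lam t)⁻¹ • (fun x => v t x - lam t • V (lam t • x)) ((lam t)⁻¹ • y)) := by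
    funext y
    simp only [Pi.neg_apply, smul_sub, smul_smul, inv_mul_cancel₀ hl0, mul_inv_cancel₀ hl0, one_smul,
      neg_sub]
  rw [hfun, eLpNorm_neg, CoreProof.eLpNorm_zoom ENNReal.coe_ne_top hgm hlt]
  unfold modulatedDeviation
  rw [ENNReal.coe_toReal]

/-- **The heart of the modulated G1**: `∫ (∂_w φ) • V̄ = 0` for every test `φ` and direction `w`. -/
theorem integral_test_eq_zero_mod {T : ℝ} (hT : 0 < T) {p : ℝ≥0} (hp2 : 2 ≤ p)
    {v : ℝ → E3 → E3} (hLH : IsLerayHopfOn T 1 0 (v 0) v) {lam : ℝ → ℝ}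
    (hlam : Tendsto lam (𝓝[<] T) atTop)
    (hdiv : ∀ ε : ℝ, 0 < ε → ε < T → ∫⁻ t in Ioo (T - ε) T, ENNReal.ofReal (lam t) = ⊤)
    {V : E3 → E3} (hV : MemLp V (p : ℝ≥0∞) volume)
    (hdev : Tendsto (modulatedDeviation lam p v V) (𝓝[<] T) (𝓝 0))
    {φ : E3 → ℝ} (hφ : IsTestFunctionOn (⊤ : TopologicalSpace.Opens E3) φ) (w : E3) :
    ∫ x, (fderiv ℝ φ x w) • V x = 0 := by
  have hp0' : p ≠ 0 := (lt_of_lt_of_le two_pos hp2).ne'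
  have hp1 : (1 : ℝ≥0∞) ≤ (p : ℝ≥0∞) := by exact_mod_cast le_trans one_le_two hp2
  have hVm : AEStronglyMeasurable V volume := hV.aestronglyMeasurable
  obtain ⟨G, hGae, hGfin, -, -⟩ := hLH.weakGrad_energy
  obtain ⟨C, hCtop, hC⟩ := test_pairing_le hφ w hp1
  set A : ℝ≥0∞ := eLpNorm φ 2 volume * ‖w‖ₑ with hA
  have hφ2 : eLpNorm φ 2 volume < ⊤ :=
    (hφ.contDiff.continuous.memLp_of_hasCompactSupport (μ := volume) (p := 2) hφ.hasCompactSupport).eLpNorm_lt_top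
  have hAtop : A ≠ ⊤ := ENNReal.mul_ne_top hφ2.ne enorm_ne_top
  have hdφc : Continuous fun x => fderiv ℝ φ x w :=
    (hφ.contDiff.continuous_fderiv (by simp)).clm_apply continuous_const
  have hdφs : HasCompactSupport fun x => fderiv ℝ φ x w := hφ.hasCompactSupport.fderiv_apply ℝ w
  have hIV : Integrable (fun x => (fderiv ℝ φ x w) • V x) volume :=
    (hV.locallyIntegrable hp1).integrable_smul_left_of_hasCompactSupport hdφc hdφs
  rw [← enorm_eq_zero]
  refine le_antisymm (ENNReal.le_of_forall_pos_le_add fun ε hε _ => ?_) bot_le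
  rw [zero_add]
  have hε' : (ε : ℝ≥0∞) / 2 ≠ 0 := by
    have : (ε : ℝ≥0∞) ≠ 0 := by exact_mod_cast hε.ne'
    exact (ENNReal.div_pos_iff.2 ⟨this, ENNReal.ofNat_ne_top⟩).ne'
  set κ₁ : ℝ≥0∞ := (ε : ℝ≥0∞) / 2 / (C + 1) with hκ₁
  set κ₂ : ℝ≥0∞ := (ε : ℝ≥0∞) / 2 / (A + 1) with hκ₂
  have hC1 : C + 1 ≠ ⊤ := ENNReal.add_ne_top.2 ⟨hCtop, ENNReal.one_ne_top⟩
  have hA1 : A + 1 ≠ ⊤ := ENNReal.add_ne_top.2 ⟨hAtop, ENNReal.one_ne_top⟩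
  have hκ₁0 : κ₁ ≠ 0 := (ENNReal.div_pos_iff.2 ⟨hε', hC1⟩).ne'
  have hκ₂0 : κ₂ ≠ 0 := (ENNReal.div_pos_iff.2 ⟨hε', hA1⟩).ne'
  have hκ₂top : κ₂ ≠ ⊤ :=
    (ENNReal.div_lt_top (ENNReal.div_lt_top ENNReal.coe_ne_top two_ne_zero).ne (by simp)).ne
  have hc0 : κ₂ ^ (2 : ℝ) ≠ 0 := by
    intro h
    rcases ENNReal.rpow_eq_zero_iff.1 h with ⟨h0, -⟩ | ⟨-, hneg⟩
    · exact hκ₂0 h0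
    · norm_num at hneg
  have hctop : κ₂ ^ (2 : ℝ) ≠ ⊤ := ENNReal.rpow_ne_top_of_nonneg (by norm_num) hκ₂top
  -- eventually the deviation is below κ₁ and λ > 0
  have hev : ∀ᶠ t in 𝓝[<] T, modulatedDeviation lam p v V t ≤ κ₁ :=
    ENNReal.tendsto_nhds_zero.1 hdev κ₁ (pos_iff_ne_zero.2 hκ₁0)
  obtain ⟨T₁, hT₁T, hT₁⟩ := mem_nhdsLT_iff_exists_Ioo_subset.1 hev
  have hevpos : ∀ᶠ t in 𝓝[<] T, 0 < lam t := hlam.eventually (eventually_gt_atTop 0)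
  obtain ⟨T₃, hT₃T, hT₃⟩ := mem_nhdsLT_iff_exists_Ioo_subset.1 hevpos
  -- the time window
  set T₂ : ℝ := max T₁ (max T₃ (T / 2)) with hT₂
  have hT₂T : T₂ < T := max_lt hT₁T (max_lt hT₃T (by linarith))
  have hT₂pos : 0 < T₂ := lt_of_lt_of_le (by linarith) (le_trans (le_max_right _ _) (le_max_right _ _))
  have hsub : Ioo T₂ T ⊆ Ioo 0 T := Ioo_subset_Ioo hT₂pos.le le_rfl
  have hP : ∀ᵐ t ∂(volume.restrict (Ioo T₂ T)), HasWeakGradient (v t) (G t) :=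
    ae_restrict_of_ae_restrict_of_subset hsub hGae
  have hF : ∫⁻ t in Ioo T₂ T, (∫⁻ x, ENNReal.ofReal (frobeniusNormSq (G t x))) ≠ ⊤ :=
    ne_top_of_le_ne_top hGfin.ne (lintegral_mono_set hsub)
  have hg : ∫⁻ t in Ioo T₂ T, ENNReal.ofReal (lam t) = ⊤ := by
    have := hdiv (T - T₂) (sub_pos.2 hT₂T) (by linarith)
    rwa [sub_sub_cancel] at this
  obtain ⟨t, hts, hGt, hFt⟩ := exists_good_time measurableSet_Ioo hP hF hg hc0 hctop
  have htT : t < T := hts.2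
  have hT₁t : T₁ < t := lt_of_le_of_lt (le_max_left _ _) hts.1
  have hT₃t : T₃ < t := lt_of_le_of_lt (le_trans (le_max_left _ _) (le_max_right _ _)) hts.1
  have ht0 : 0 < t := lt_trans hT₂pos hts.1
  have hlt : 0 < lam t := hT₃ ⟨hT₃t, htT⟩
  set ℓ : ℝ := (lam t)⁻¹ with hℓ
  have hℓpos : 0 < ℓ := inv_pos.2 hlt
  have hℓ0 : ℓ ≠ 0 := hℓpos.ne'
  have hδ : modulatedDeviation lam p v V t ≤ κ₁ := hT₁ ⟨hT₁t, htT⟩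
  have hvt2 : MemLp (v t) 2 volume := hLH.memLp t ⟨ht0.le, htT.le⟩
  have hvtm : AEStronglyMeasurable (v t) volume := hvt2.aestronglyMeasurable
  have hWm : AEStronglyMeasurable (fun y => ℓ • v t (ℓ • y)) volume :=
    (hvtm.comp_quasiMeasurePreserving
      (Literature.Analysis.OperatorTheory.quasiMeasurePreserving_smul' hℓ0)).const_smul ℓ
  have hW2 : MemLp (fun y => ℓ • v t (ℓ • y)) 2 volume :=
    (Literature.Analysis.OperatorTheory.memLp_comp_smul hvt2 hℓ0).const_smul ℓ
  have hIW : Integrable (fun x => (fderiv ℝ φ x w) • (ℓ • v t (ℓ • x))) volume :=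
    (hW2.locallyIntegrable one_le_two).integrable_smul_left_of_hasCompactSupport hdφc hdφs
  have hsplit : ∫ x, (fderiv ℝ φ x w) • V x =
      (∫ x, (fderiv ℝ φ x w) • (V x - ℓ • v t (ℓ • x))) + ∫ x, (fderiv ℝ φ x w) • (ℓ • v t (ℓ • x)) := by
    have hsub' : Integrable (fun x => (fderiv ℝ φ x w) • (V x - ℓ • v t (ℓ • x))) volume := by
      have h := hIV.sub hIW
      refine h.congr (Eventually.of_forall fun x => ?_)
      simp only [Pi.sub_apply, smul_sub]
    rw [← integral_add hsub' hIW]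
    congr 1
    funext x
    rw [smul_sub, sub_add_cancel]
  have h1 : ‖∫ x, (fderiv ℝ φ x w) • (V x - ℓ • v t (ℓ • x))‖ₑ ≤ (ε : ℝ≥0∞) / 2 := by
    calc ‖∫ x, (fderiv ℝ φ x w) • (V x - ℓ • v t (ℓ • x))‖ₑ
        ≤ C * eLpNorm (fun x => V x - ℓ • v t (ℓ • x)) p volume := hC _ (hVm.sub hWm)
      _ = C * modulatedDeviation lam p v V t := by
          rw [hℓ, eLpNorm_profile_sub_zoom_mod hVm hlt hvtm]
      _ ≤ C * κ₁ := by gcongr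
      _ ≤ (C + 1) * κ₁ := by gcongr; exact le_self_add
      _ = (ε : ℝ≥0∞) / 2 := ENNReal.mul_div_cancel (by simp) hC1
  have hℓF : ENNReal.ofReal ℓ * ∫⁻ x, ENNReal.ofReal (frobeniusNormSq (G t x)) ≤ κ₂ ^ (2 : ℝ) := by
    calc ENNReal.ofReal ℓ * ∫⁻ x, ENNReal.ofReal (frobeniusNormSq (G t x))
        ≤ ENNReal.ofReal ℓ * (κ₂ ^ (2 : ℝ) * ENNReal.ofReal (lam t)) := by gcongr
      _ = κ₂ ^ (2 : ℝ) * (ENNReal.ofReal ℓ * ENNReal.ofReal (lam t)) := by ring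
      _ = κ₂ ^ (2 : ℝ) := by
          rw [hℓ, ← ENNReal.ofReal_mul hℓpos.le, inv_mul_cancel₀ hlt.ne', ENNReal.ofReal_one, mul_one]
  have h2 : ‖∫ x, (fderiv ℝ φ x w) • (ℓ • v t (ℓ • x))‖ₑ ≤ (ε : ℝ≥0∞) / 2 := by
    calc ‖∫ x, (fderiv ℝ φ x w) • (ℓ • v t (ℓ • x))‖ₑ
        ≤ eLpNorm φ 2 volume * ‖w‖ₑ * ENNReal.ofReal ℓ ^ (1 / 2 : ℝ) *
            (∫⁻ x, ENNReal.ofReal (frobeniusNormSq (G t x))) ^ (1 / 2 : ℝ) :=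
          zoom_pairing_le hGt hφ hℓpos w
      _ = A * (ENNReal.ofReal ℓ * ∫⁻ x, ENNReal.ofReal (frobeniusNormSq (G t x))) ^ (1 / 2 : ℝ) := by
          rw [hA, ENNReal.mul_rpow_of_nonneg _ _ (by norm_num)]; ring
      _ ≤ A * (κ₂ ^ (2 : ℝ)) ^ (1 / 2 : ℝ) := by gcongr
      _ = A * κ₂ := by rw [← ENNReal.rpow_mul]; norm_num
      _ ≤ (A + 1) * κ₂ := by gcongr; exact le_self_add
      _ = (ε : ℝ≥0∞) / 2 := ENNReal.mul_div_cancel (by simp) hA1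
  calc ‖∫ x, (fderiv ℝ φ x w) • V x‖ₑ
      = ‖(∫ x, (fderiv ℝ φ x w) • (V x - ℓ • v t (ℓ • x))) +
          ∫ x, (fderiv ℝ φ x w) • (ℓ • v t (ℓ • x))‖ₑ := by rw [hsplit]
    _ ≤ ‖∫ x, (fderiv ℝ φ x w) • (V x - ℓ • v t (ℓ • x))‖ₑ +
          ‖∫ x, (fderiv ℝ φ x w) • (ℓ • v t (ℓ • x))‖ₑ := enorm_add_le _ _
    _ ≤ (ε : ℝ≥0∞) / 2 + (ε : ℝ≥0∞) / 2 := add_le_add h1 h2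
    _ = ε := ENNReal.add_halves _

/-- **G1 — the modulated DISSIPATION GATE, PROVED.** -/
theorem modulatedDissipationGate_holds : ModulatedDissipationGate := by
  intro T hT p hp2 v π hv hLH lam hmod hdiv V hV hdev
  have hp0 : ((p : ℝ≥0∞)) ≠ 0 := by
    have : p ≠ 0 := (lt_of_lt_of_le two_pos hp2).ne'
    exact_mod_cast this
  have hp1 : (1 : ℝ≥0∞) ≤ (p : ℝ≥0∞) := by exact_mod_cast le_trans one_le_two hp2
  refine ae_eq_zero_of_hasWeakGradient_zero ⟨?_, ?_, ?_⟩ hp0 ENNReal.coe_ne_top hV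
  · simpa only [TopologicalSpace.Opens.coe_top] using (hV.locallyIntegrable hp1).locallyIntegrableOn Set.univ
  · simpa only [TopologicalSpace.Opens.coe_top] using
      (locallyIntegrable_const (0 : E3 →L[ℝ] E3)).locallyIntegrableOn Set.univ
  · intro φ w hφ
    simp only [TopologicalSpace.Opens.coe_top, Measure.restrict_univ, zero_apply,
      smul_zero, integral_zero, neg_zero]
    exact integral_test_eq_zero_mod hT hp2 hLH hmod.tendsto_atTop hdiv hV hdev hφ w

end DissipationProof

/-- **G1 `ModulatedDissipationGate` — PROVED (rev 4; sorry-free).** -/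
theorem modulatedDissipationGate_holds' : ModulatedDissipationGate :=
  DissipationProof.modulatedDissipationGate_holds

end Summit.NavierStokesRegularity.NavierStokesRegularity.Theorems.ScenarioCensus.ModulationGate

end
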